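import Literature.AlgebraicGeometry.HodgeTheory.BlochSemiregularityMapReal
import Literature.AlgebraicGeometry.Modules.SheafHomLeft
import HarnessLib

/-!
# Functoriality of `multiHom I T r` and `𝓐lt_r(I; T)` along isomorphisms `I ≅ I'`, `T ≅ T'`

Layer `Literature/AlgebraicGeometry/HodgeTheory`; companion of `BlochSemiregularityMapReal.lean` (the
iterated internal Hom `multiHom I T r = 𝓗om(I, 𝓗om(I, … T …))` on a scheme `Y`, its evaluation `evalMulti`
on tuples of sections of `I`, the alternating subsheaf `altMultiHom I T r = 𝓐lt_r(I; T)` with inclusion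
`altι`). For isomorphisms of `𝒪_Y`-modules `α : I ≅ I'`, `β : T ≅ T'` this file PROVES (no named facts):

* `multiHomMapIso α β r : multiHom I T r ≅ multiHom I' T' r` (induction: `𝓗om(I, –)` of the previous
  step — the tree's `sheafHomFunctor` — then `𝓗om(α⁻¹, –)` — the tree's `sheafHomMapLeftIso`);
* `evalMulti_multiHomMapIso_hom_app : (multiHomMapIso α β r φ)(a') = β (φ (α⁻¹ ∘ a'))`;
* `isAltSection_multiHomMapIso_hom_app_iff`, `altMultiHomMapHom` (lift through `altι`),
  `altMultiHomMapIso α β r : 𝓐lt_r(I; T) ≅ 𝓐lt_r(I'; T')` with `altι_app_altMultiHomMapHom_app`.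

Motivation (venture HSemireg, bridge (B1), residual gap (T), step W3(c3)): after transporting Bloch's
pairing target along an isomorphism `ε` of the ambient scheme (`Modules/SheafHomPushforward`,
`MultiHomPushforward`), the input data on the new scheme are only ISOMORPHIC to the transported ones
(`𝓘_{i≫ε} ≅ ε_*𝓘_i` — `Deformation/IdealModulePushforward`; `Ωⁿ|_Z` — `Modules/PushforwardIsoAdjunction`);
this file moves `multiHom`/`𝓐lt` along such isomorphisms, with the evaluation formula needed to compare
the pairings.

References: The Stacks project, Tag 01CM (Modules: internal Hom, functorial in both variables);
R. Hartshorne, *Algebraic Geometry* (1977), II.5 p. 109. The statements are the iterated / alternating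
reading of that functoriality. [StacksProject] [Hartshorne1977]
-/

noncomputable section

-- `TopCat.Presheaf`/`Scheme.Modules` are not reducible (as in Mathlib's `AlgebraicGeometry/Modules/Sheaf.lean`).
set_option backward.isDefEq.respectTransparency false

open CategoryTheory AlgebraicGeometry Opposite TopologicalSpace

universe u

namespace Literature.AlgebraicGeometry.HodgeTheory

open Literature.AlgebraicGeometry.Modules

section MapIso

variable {Y : Scheme.{u}} {I I' T T' : Y.Modules} (α : I ≅ I') (β : T ≅ T')

/-- **`multiHom I T r ≅ multiHom I' T' r`** for isomorphisms `α : I ≅ I'`, `β : T ≅ T'`, by induction on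
`r` (`r = 0`: `β`; step: `𝓗om(I, –)` of the previous isomorphism, then `𝓗om(α⁻¹, –)`).
[cite: StacksProject, Tag 01CM (internal Hom is a functor in both variables; reading: iterated)] -/
def multiHomMapIso : (r : ℕ) → (multiHom I T r ≅ multiHom I' T' r)
  | 0 => β
  | r + 1 => (sheafHomFunctor I).mapIso (multiHomMapIso r) ≪≫ sheafHomMapLeftIso α (multiHom I' T' r)

/-- Unfolding the successor step of `multiHomMapIso` on a section. [folklore] -/
private theorem multiHomMapIso_succ_hom_app (r : ℕ) (U : Y.Opens) (φ : Γ(multiHom I T (r + 1), U)) :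
    (multiHomMapIso α β (r + 1)).hom.app U φ =
      (sheafHomMapLeft α.inv (multiHom I' T' r)).app U
        ((sheafHomMap I (multiHomMapIso α β r).hom).app U φ) := by
  change ((sheafHomFunctor I).map (multiHomMapIso α β r).hom ≫
    sheafHomMapLeft α.inv (multiHom I' T' r)).app U φ = _
  rw [Scheme.Modules.Hom.comp_app]
  rfl

/-- **Evaluation on tuples under `multiHomMapIso`**: `(multiHomMapIso α β r φ)(a') = β (φ (α⁻¹ a'))`.
[cite: StacksProject, Tag 01CM (internal Hom is a functor in both variables; reading: iterated)] -/
theorem evalMulti_multiHomMapIso_hom_app : (r : ℕ) → ∀ {U W : Y.Opens} (φ : Γ(multiHom I T r, U))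
    (k : W ⟶ U) (a' : Fin r → Γ(I', W)),
    evalMulti I' T' r ((multiHomMapIso α β r).hom.app U φ) k a' =
      β.hom.app W (evalMulti I T r φ k (fun s => α.inv.app W (a' s)))
  | 0, U, W, φ, k, a' => by
    change T'.presheaf.map k.op (β.hom.app U φ) = β.hom.app W (T.presheaf.map k.op φ)
    exact (PresheafOfModules.naturality_apply β.hom.val k.op φ).symm
  | r + 1, U, W, φ, k, a' => by
    rw [evalMulti_succ, evalMulti_succ, multiHomMapIso_succ_hom_app]
    dsimp only [multiHomSucc]
    rw [sheafHomMapLeft_app_apply, appLE_over_map_comp, sheafHomMap_app_apply, appLE_comp_over_map,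
      evalMulti_multiHomMapIso_hom_app r]
    rfl

/-- A section is alternating iff its image under `multiHomMapIso` is.
[cite: StacksProject, Tag 01CM (internal Hom is a functor in both variables; reading: iterated, alternating part)] -/
theorem isAltSection_multiHomMapIso_hom_app_iff (r : ℕ) {U : Y.Opens} (φ : Γ(multiHom I T r, U)) :
    IsAltSection I' T' r U ((multiHomMapIso α β r).hom.app U φ) ↔ IsAltSection I T r U φ := by
  constructor
  · intro h W k a s t hst hat
    have key := h k (fun j => α.hom.app W (a j)) s t hst (by simp only [hat])
    rw [evalMulti_multiHomMapIso_hom_app] at key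
    have ha : (fun j => α.inv.app W (α.hom.app W (a j))) = a := by
      funext j
      change (α.hom ≫ α.inv).app W (a j) = a j
      rw [α.hom_inv_id]
      rfl
    rw [ha] at key
    have h2 := congrArg (β.inv.app W) key
    rw [map_zero] at h2
    change (β.hom ≫ β.inv).app W _ = 0 at h2
    rw [β.hom_inv_id] at h2
    exact h2
  · intro h W k a' s t hst hat
    rw [evalMulti_multiHomMapIso_hom_app, h k _ s t hst (by simp only [hat]), map_zero]

/-- A morphism into `multiHom I T r` with alternating values lifts to `𝓐lt_r(I; T)` (local copy of the
`altLift` of `MultiHomPushforward.lean`, kept private to avoid a name clash). [folklore] -/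
private def altLift' {N : Y.Modules} {r : ℕ} (ψ : N ⟶ multiHom I' T' r)
    (h : ∀ (U : Y.Opens) (x : Γ(N, U)), IsAltSection I' T' r U (ψ.app U x)) :
    N ⟶ altMultiHom I' T' r where
  val := PresheafOfModules.homMk
    { app := fun U => AddCommGrpCat.ofHom
        ((ψ.val.app U).hom.toAddMonoidHom.codRestrict (altSubmoduleObj I' T' r U.unop) (h U.unop))
      naturality := fun {U V} l => by
        ext x
        apply Subtype.ext
        exact PresheafOfModules.naturality_apply ψ.val l x }
    (fun U a x => Subtype.ext ((ψ.val.app U).hom.map_smul a x))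

/-- **`𝓐lt_r(I; T) ⟶ 𝓐lt_r(I'; T')`** induced by `α`, `β`: the inclusion, `multiHomMapIso`, lifted.
[cite: StacksProject, Tag 01CM (internal Hom is a functor in both variables; reading: iterated, alternating part)] -/
def altMultiHomMapHom (r : ℕ) : altMultiHom I T r ⟶ altMultiHom I' T' r :=
  altLift' (altι I T r ≫ (multiHomMapIso α β r).hom)
    (fun U x => (isAltSection_multiHomMapIso_hom_app_iff α β r _).mpr (isAltSection_altι_app I T r U x))

/-- `altMultiHomMapHom ≫ altι = altι ≫ multiHomMapIso.hom`.
[cite: StacksProject, Tag 01CM (internal Hom is a functor in both variables; reading: iterated, alternating part)] -/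
@[simp]
theorem altMultiHomMapHom_comp_altι (r : ℕ) :
    altMultiHomMapHom α β r ≫ altι I' T' r = altι I T r ≫ (multiHomMapIso α β r).hom :=
  Scheme.Modules.hom_ext _ _ fun _ => rfl

/-- Sections: `altι (altMultiHomMapHom x) = multiHomMapIso.hom (altι x)`.
[cite: StacksProject, Tag 01CM (internal Hom is a functor in both variables; reading: iterated, alternating part)] -/
theorem altι_app_altMultiHomMapHom_app (r : ℕ) (U : Y.Opens) (x : Γ(altMultiHom I T r, U)) :
    (altι I' T' r).app U ((altMultiHomMapHom α β r).app U x) =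
      (multiHomMapIso α β r).hom.app U ((altι I T r).app U x) := rfl

/-- **`altMultiHomMapHom` is an isomorphism** (bijective on sections). [folklore] -/
instance isIso_altMultiHomMapHom (r : ℕ) : IsIso (altMultiHomMapHom α β r) := by
  refine Scheme.Modules.Hom.isIso_iff_isIso_app.mpr fun U => ?_
  rw [ConcreteCategory.isIso_iff_bijective]
  have hinj : Function.Injective ((multiHomMapIso α β r).hom.app U) :=
    (ConcreteCategory.bijective_of_isIso ((multiHomMapIso α β r).hom.app U)).1
  constructor
  · intro x y hxy
    have h := congrArg ((altι I' T' r).app U) hxy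
    rw [altι_app_altMultiHomMapHom_app, altι_app_altMultiHomMapHom_app] at h
    exact altι_app_injective I T r U (hinj h)
  · intro ψ
    let φ : Γ(multiHom I T r, U) := (multiHomMapIso α β r).inv.app U ((altι I' T' r).app U ψ)
    have hφ' : (multiHomMapIso α β r).hom.app U φ = (altι I' T' r).app U ψ := by
      change ((multiHomMapIso α β r).inv ≫ (multiHomMapIso α β r).hom).app U _ = _
      rw [Iso.inv_hom_id, Scheme.Modules.Hom.id_app]
      rfl
    have halt : IsAltSection I T r U φ := by
      rw [← isAltSection_multiHomMapIso_hom_app_iff α β, hφ']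
      exact isAltSection_altι_app I' T' r U ψ
    refine ⟨(⟨φ, halt⟩ : altSubmoduleObj I T r U), ?_⟩
    apply altι_app_injective I' T' r U
    rw [altι_app_altMultiHomMapHom_app]
    exact hφ'

/-- **`𝓐lt_r(I; T) ≅ 𝓐lt_r(I'; T')`** for isomorphisms `α : I ≅ I'`, `β : T ≅ T'`.
[cite: StacksProject, Tag 01CM (internal Hom is a functor in both variables; reading: iterated, alternating part)] -/
def altMultiHomMapIso (r : ℕ) : altMultiHom I T r ≅ altMultiHom I' T' r :=
  asIso (altMultiHomMapHom α β r)

end MapIso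

end Literature.AlgebraicGeometry.HodgeTheory

end
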